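import Summits.Ventures.HSemireg.WedgeHankelRecurrenceGaussChebyshevCSResultantClosed

/-!
# Venture HSemireg — **McDANIEL'S MIXED GCD LAW FOR LUCAS SEQUENCES WITH `Q = 1`: `gcd(V_m, U_n) = |V_{gcd(m,n)}|` IF `n ∕ gcd(m,n)` IS EVEN, AND `gcd(V_m, U_n) = gcd(2, U_{gcd(m,n)}) ∈ {1, 2}`
# OTHERWISE** (every integer `P`; `U_0 = 0, U_1 = 1`, `V_0 = 2, V_1 = P`, both with `x_{k+2} = P x_{k+1} − x_k`, so `U_n = S_{n−1}(P)`, `V_m = C_m(P)`), and the polynomial form over `ℤ[X]`: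
# **`C_m` and `S_{n−1}` are coprime in `ℤ[X]` iff `gcd(m,n) = 1` and `n` is odd** — corollaries of the monic mixed ideal N481 `(C_m, S_{n−1}) = (C_g)` resp. `(2, S_{g−1})` by evaluation at
# `X = P` resp. reduction modulo `2`

HONEST FRAMING. Part of the Lean index of the computation cell `pub-hsemireg` (seat p10 gen 48, Sunday typer «UNIFORM-IN-n»).  Integer ∕ ideal arithmetic only; no variety, no cohomology theory,
no sheaf, no Ext group and no semiregularity map is constructed here; nothing here says that HC / HC_CM / HC_AV holds; no Literature fact (unproved `Prop`) is declared or used.  Custodian versions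
as in `WedgeHankelSiegelIdeal` (1/3).
SOURCES (cited).  W. L. McDaniel, *The g.c.d. in Lucas sequences and Lehmer number sequences*, Fibonacci Quart. 29 (1991) 24–29, Main Theorem (iii) (case `Q = 1`); P. Ribenboim, *My Numbers, My
Friends* (2000), Ch. 1 §IV.
PROOF TYPED HERE.  N481 `chebyshevCS_span_pair_dichotomy ∕ _eq_span_gcd ∕ _eq_span_two_gcd`; N476 `int_gcd_eq_natAbs_of_span_pair_eq`, `int_gcd_eq_of_span_pair_eq`, `lucasV_one_eq_chebyshevC_eval`; N465
`chebyshevS_natDegree_monic`; `Literature…ChebyshevChains.monic_chebyshevC_and_natDegree`; Mathlib `Polynomial.evalRingHom`, `Ideal.map_span`, `Ideal.map_top`, `Polynomial.mapRingHom`, `map_C ∕ map_S`,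
`Ideal.span_singleton_eq_top`, `Polynomial.natDegree_eq_zero_of_isUnit`, `S_add_two`.
DEDUP DISCLOSURE (`rg -n 'lucasU_one_eq_chebyshevS_eval|lucasUV_one_gcd|chebyshevCS_int_isCoprime_iff' Summits Literature HarnessLib`, 2026-09-04): `Literature/NumberTheory/LucasSequences/Divisibility.lean`
`gcd_U_V_eq_one_or_two` (same index, general `P, Q`) — the two-index law below is not there; 0 hits for the 4 names below.

WHAT IS IN THE TREE.  N476, N481; Literature `LucasSequences.Divisibility`.
THIS FILE (namespace `Summit.Ventures.HSemireg.Wedge.HankelOuter` continued; CHAINED on N482; 0 definitions):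
* §1248 `lucasU_one_eq_chebyshevS_eval`, **`lucasUV_one_gcd`** (McDaniel (iii), `Q = 1`), `lucasUV_one_gcd_dvd_two`, **`chebyshevCS_int_isCoprime_iff`**.
CAVEATS.  `Q = 1` only; `ℕ`-division conventions as in N458.  Nothing Ext-side.  New names only.
-/

open Module Polynomial
open scoped Matrix Polynomial

namespace Summit.Ventures.HSemireg.Wedge.HankelOuter

/-! ## §1248. `gcd(V_m, U_n)` for the Lucas pair with `Q = 1`, and coprimality of `C_m`, `S_{n−1}` over `ℤ` -/

/-- `U_n(P, 1) = S_{n−1}(P)`: the Lucas sequence of the first kind with `Q = 1` is the Vieta–Fibonacci polynomial evaluated at `P`. [Hoggatt–Long 1974; this file, §1248] -/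
theorem lucasU_one_eq_chebyshevS_eval {P : ℤ} {U : ℕ → ℤ} (hU0 : U 0 = 0) (hU1 : U 1 = 1) (hU : ∀ n, U (n + 2) = P * U (n + 1) - U n) (n : ℕ) :
    U n = (Polynomial.Chebyshev.S ℤ ((n : ℤ) - 1)).eval P := by
  induction n using Nat.strong_induction_on with
  | _ n ih =>
    rcases n with _ | _ | k
    · rw [hU0, Nat.cast_zero, zero_sub, Polynomial.Chebyshev.S_neg_one, eval_zero]
    · rw [hU1, Nat.cast_one, sub_self, Polynomial.Chebyshev.S_zero, eval_one]
    · rw [hU k, ih k (by omega), ih (k + 1) (by omega), show (((k + 2 : ℕ)) : ℤ) - 1 = ((k : ℤ) - 1) + 2 by push_cast; ring, Polynomial.Chebyshev.S_add_two,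
        show (((k + 1 : ℕ)) : ℤ) - 1 = ((k : ℤ) - 1) + 1 by push_cast; ring, eval_sub, eval_mul, eval_X]

/-- **McDANIEL'S MIXED LAW (`Q = 1`): `gcd(V_m, U_n) = |V_{gcd(m,n)}|` if `n ∕ gcd(m,n)` is even, and `= gcd(2, U_{gcd(m,n)})` otherwise**, for `U_0 = 0, U_1 = 1`, `V_0 = 2, V_1 = P`,
`x_{k+2} = P x_{k+1} − x_k` over `ℤ`. [McDaniel 1991, Main Theorem (iii); this file, §1248] -/
theorem lucasUV_one_gcd {P : ℤ} {U V : ℕ → ℤ} (hU0 : U 0 = 0) (hU1 : U 1 = 1) (hU : ∀ n, U (n + 2) = P * U (n + 1) - U n)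
    (hV0 : V 0 = 2) (hV1 : V 1 = P) (hV : ∀ n, V (n + 2) = P * V (n + 1) - V n) (m n : ℕ) :
    Int.gcd (V m) (U n) = if Even (n / Nat.gcd m n) then (V (Nat.gcd m n)).natAbs else Int.gcd 2 (U (Nat.gcd m n)) := by
  have hevV : ∀ k : ℕ, Polynomial.evalRingHom P (Polynomial.Chebyshev.C ℤ (k : ℤ)) = V k := fun k => by
    rw [Polynomial.coe_evalRingHom, lucasV_one_eq_chebyshevC_eval hV0 hV1 hV k]
  have hevU : ∀ k : ℕ, Polynomial.evalRingHom P (Polynomial.Chebyshev.S ℤ ((k : ℤ) - 1)) = U k := fun k => by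
    rw [Polynomial.coe_evalRingHom, lucasU_one_eq_chebyshevS_eval hU0 hU1 hU k]
  obtain ⟨h1, h2⟩ := chebyshevCS_span_pair_dichotomy (R := ℤ) m n
  by_cases hP : Even (n / Nat.gcd m n)
  · rw [if_pos hP]
    have h := congrArg (Ideal.map (Polynomial.evalRingHom P)) (h1 hP)
    rw [Ideal.map_span, Ideal.map_span, Set.image_pair, Set.image_singleton, hevV, hevU, hevV] at h
    exact int_gcd_eq_natAbs_of_span_pair_eq h
  · rw [if_neg hP]
    have h := congrArg (Ideal.map (Polynomial.evalRingHom P)) (h2 hP)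
    rw [Ideal.map_span, Ideal.map_span, Set.image_pair, Set.image_pair, hevV, hevU, hevU, Polynomial.coe_evalRingHom,
      show (2 : ℤ[X]) = Polynomial.C 2 from (Polynomial.C_ofNat 2).symm, eval_C] at h
    exact int_gcd_eq_of_span_pair_eq h

/-- Hence when `n ∕ gcd(m,n)` is odd, `gcd(V_m, U_n) ∣ 2`. [McDaniel 1991; this file, §1248] -/
theorem lucasUV_one_gcd_dvd_two {P : ℤ} {U V : ℕ → ℤ} (hU0 : U 0 = 0) (hU1 : U 1 = 1) (hU : ∀ n, U (n + 2) = P * U (n + 1) - U n)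
    (hV0 : V 0 = 2) (hV1 : V 1 = P) (hV : ∀ n, V (n + 2) = P * V (n + 1) - V n) {m n : ℕ} (h : ¬ Even (n / Nat.gcd m n)) :
    Int.gcd (V m) (U n) ∣ 2 := by
  rw [lucasUV_one_gcd hU0 hU1 hU hV0 hV1 hV m n, if_neg h, Int.gcd_eq_natAbs]
  exact Nat.gcd_dvd_left 2 _

/-- **`C_m` and `S_{n−1}` are coprime in `ℤ[X]` iff `gcd(m,n) = 1` and `n` is odd** (the ideal is `(C_g)` or `(2, S_{g−1})`; reduce modulo `2`). [this file, §1248] -/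
theorem chebyshevCS_int_isCoprime_iff (m n : ℕ) :
    IsCoprime (Polynomial.Chebyshev.C ℤ (m : ℤ)) (Polynomial.Chebyshev.S ℤ ((n : ℤ) - 1)) ↔ Nat.gcd m n = 1 ∧ Odd n := by
  constructor
  · intro hc
    have htop := (span_pair_eq_top_iff_isCoprime _ _).2 hc
    by_cases hP : Even (n / Nat.gcd m n)
    · -- `(C_g) = ⊤` is impossible in `ℤ[X]`
      exfalso
      rw [chebyshevCS_span_pair_eq_span_gcd hP, Ideal.span_singleton_eq_top] at htop
      rcases Nat.eq_zero_or_pos (Nat.gcd m n) with h0 | hg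
      · rw [h0, Nat.cast_zero, Polynomial.Chebyshev.C_zero, show (2 : ℤ[X]) = Polynomial.C 2 from (Polynomial.C_ofNat 2).symm, Polynomial.isUnit_C, Int.isUnit_iff] at htop
        rcases htop with h | h <;> norm_num at h
      · obtain ⟨g, hg'⟩ : ∃ g, Nat.gcd m n = g + 1 := ⟨Nat.gcd m n - 1, by omega⟩
        have hdeg := Polynomial.natDegree_eq_zero_of_isUnit htop
        rw [hg', (Literature.Algebra.Polynomial.ChebyshevChains.monic_chebyshevC_and_natDegree (R := ℤ) g).2] at hdeg
        omega
    · rw [chebyshevCS_span_pair_eq_span_two_gcd hP] at htop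
      -- reduce modulo `2`: `S_{g−1}` is a unit in `𝔽₂[X]`, hence `g = 1`
      have h2 := congrArg (Ideal.map (Polynomial.mapRingHom (Int.castRingHom (ZMod 2)))) htop
      rw [Ideal.map_span, Set.image_pair, Ideal.map_top, Polynomial.coe_mapRingHom, Polynomial.Chebyshev.map_S, show (2 : ℤ[X]) = Polynomial.C 2 from (Polynomial.C_ofNat 2).symm,
        Polynomial.map_C, eq_intCast, show ((2 : ℤ) : ZMod 2) = 0 from rfl, map_zero, Ideal.span_insert_zero, Ideal.span_singleton_eq_top] at h2
      rcases Nat.eq_zero_or_pos (Nat.gcd m n) with h0 | hg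
      · rw [h0, Nat.cast_zero, zero_sub, Polynomial.Chebyshev.S_neg_one] at h2
        exact absurd h2 not_isUnit_zero
      · obtain ⟨g, hg'⟩ : ∃ g, Nat.gcd m n = g + 1 := ⟨Nat.gcd m n - 1, by omega⟩
        have hdeg := Polynomial.natDegree_eq_zero_of_isUnit h2
        rw [hg', show (((g + 1 : ℕ)) : ℤ) - 1 = (g : ℤ) by push_cast; ring, (chebyshevS_natDegree_monic (R := ZMod 2) g).1] at hdeg
        subst hdeg
        rw [zero_add] at hg'
        refine ⟨hg', ?_⟩
        rw [hg', Nat.div_one] at hP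
        exact Nat.not_even_iff_odd.1 hP
  · rintro ⟨hg, hodd⟩
    have hP : ¬ Even (n / Nat.gcd m n) := by rw [hg, Nat.div_one]; exact Nat.not_even_iff_odd.2 hodd
    rw [← span_pair_eq_top_iff_isCoprime, chebyshevCS_span_pair_eq_span_two_gcd hP, hg, Nat.cast_one, sub_self, Polynomial.Chebyshev.S_zero]
    exact Ideal.eq_top_of_isUnit_mem _ (Ideal.subset_span (Set.mem_insert_of_mem _ (Set.mem_singleton _))) isUnit_one

end Summit.Ventures.HSemireg.Wedge.HankelOuter
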